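import Summits.QuantumFields.BalabanUV.T4Continuum.Spine.NE7.Targets

/-!
# BalabanUVNodes ∕ N19 (NE7) — THE PRODUCT (EXTENSIVITY) CALCULUS OF THE HYBRID NE7 DATUM, I: TWO INDEPENDENT BLOCKS
# (`Core`, `RelWeightBound`, `ShellWeightBound`, `HybridNE7` on the index `ι₁ × ι₂` — constants ADD, radii ADD, bad weights compose as
# `1 − (1 − W₁)(1 − W₂)`, shell weights add; the finite block family `Π b, κ b` and the SHARPNESS of the radius are file II
# `…N19CoreProductBlockFamily`)

Cell `pub-ymgap` (HUMAN RULING D-0062 Track A; D-0149 width push, director-ym №197), seat `pub-ymgap-dag-n19-w2` (WIDTH SEAT 2 of 3 on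
NODE n19 = NE7) gen 2.  Filed `--kind proof --supports stmt-QuantumFields-20544 --as helper` (K3⁷ `SpineGivenEndpointR13SepCoPH`);
COUNT-NEUTRAL.

WHY THIS FILE.  Node U5's NE7 datum (`T4MatchingAssembly.HybridNE7 l₀ vol T A B Bad W shA shB Wsh δ`, NE7-proper leaf
`Spine.NE7.Core l₀ vol T Bad P Q δ`) carries a VOLUME letter: the good-class sandwich has radius `vol·δ_K` («any class- or
`t`-dependence being booked into the width `vol·δ K`», `T4MatchingAssembly` §1), and `T4HybridMatching.hybridDelta` spreads the
weight remainder `−log(1 − W_K)` over `vol`.  The tree's sandwich algebra is FACTOR-wise inside ONE term (`T4HybridMatching.prod_sandwich`,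
`abs_log_prod_sub_le`: a term is a product of kinds) and CLASS-wise along ONE class map (`fiberSum`, `HybridSandwich.of_fibers`,
`T4MatchingAssembly.classVal`); what is typed here is the complementary BLOCK-wise composition of WHOLE DATA: two hybrid data on
independent index sets — the product datum's weights are the products `A₁(τ₁)·A₂(τ₂)`, its classes the pairs, a pair is BAD iff one
component is bad (`Bad₁ ×ˢ T₂ ∪ T₁ ×ˢ Bad₂`), its shell is `A₁A₂ − (A₁ − shA₁)(A₂ − shA₂)` (so that the product CORE is the product
of the cores) — compose into ONE hybrid datum with
* `Core`: constants `c₁ + c₂`, radius `vol₁·δ₁ + vol₂·δ₂` (`core_prod`); at a COMMON per-volume radius `δ` the VOLUMES ADD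
  (`core_prod_sameDelta`: `Core l₀ vol₁ … δ` ⊗ `Core l₀ vol₂ … δ` ⟹ `Core l₀ (vol₁ + vol₂) … δ`) — the extensivity that the letter `vol` records;
* `RelWeightBound` (NE7b): bad weight `W₁ + W₂ − W₁W₂ = 1 − (1 − W₁)(1 − W₂)`, nonnegative, `< 1` and summable with NO smallness
  hypothesis (`relWeightBound_prod`; term weights nonnegative = interface I-2);
* `ShellWeightBound` (NE7c): shell weight `Wsh₁ + Wsh₂` (`shellWeightBound_prod`);
* `HybridNE7`: the three above + the DISPLAYED joint smallness `W⊗ + Wsh⊗ < 1` (`hybridNE7_prod`) — the one clause that does NOT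
  compose from the factors' `W_b + Wsh_b < 1` (the honest product smallness is `(1 − W₁ − Wsh₁)(1 − W₂ − Wsh₂) > 0`; `HybridNE7` books
  bad classes and shells additively, so the product clause is displayed, not derived);
* node U5's scheme-level TARGET: `MatchingModConstants` ∕ `Spine.NE7.Target` of two POSITIVE partition-function sequences ⟹ the same
  for their product `Z₁·Z₂`, constants and radii adding (`matchingModConstants_mul`, `target_mul`); and the WEIGHT REMAINDER is extensive
  too: `−log(1 − W⊗) = −log(1 − W₁) − log(1 − W₂)`, so the shell-free `hybridDelta` of the product is the volume-weighted sum of the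
  blocks' (`neg_log_one_sub_prodWeight`, `hybridDelta_prod`).
All of it is [folklore] order arithmetic on finite sums (`Finset.sum_product`, `Finset.sum_mul_sum`, `Finset.sum_sdiff`, `mul_le_mul`);
nothing of Bałaban's is instantiated.  Where it sits: the physics reading of NE7's `vol·δ_K` — the two runs' discrepancy per unit block is
`δ_K` and blocks far apart contribute (nearly) independently, so the log-ratio spread over the torus is extensive — is the heuristics behind
[Balaban1989LargeFieldI] p.175's «relative form» and King's small-field ∕ large-field split [King1986] (3.10)–(3.13) pp.656–657 (both as
quoted in `T4HybridMatching`, template only); the exact-independence case typed here is its zeroth-order skeleton and a consistency test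
every candidate `Core` producer must pass (n19-w1's `…N19DefectGasManyClasses.core_defectGas` — MANY good classes, ONE extensive constant —
is the Bernoulli instance; cited, not restated).

HONEST FRAMING.  Count-neutral kernel bookkeeping; ZERO estimate content about Bałaban's objects (no carrier of record is a product
datum; the history-indexed weights of [Balaban1988Convergent] (2.18) do NOT factor over blocks exactly — polymer activities couple
them, which is where NE7's content lives).  NE7 ∕ NE7b ∕ NE7c NOT PRINTED for d = 4 and NOT proved; N19 NOT discharged; K3⁷ OPEN,
not claimed; counts UNMOVED (typed 28∕28 · discharged 5∕27 (A 5∕28)); no count claim.  One finite 𝕋⁴ programme at fixed ε, Bałaban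
AS PRINTED; the YM mass gap (Clay) is NOT proved by any of this — R4 closes the conditional finite-𝕋⁴ rung `BalabanLadder.UV` only;
nothing continuum ∕ ℝ⁴ ∕ OS.  No `def`, no `instance`, no `sorry`.
-/

noncomputable section

namespace Summit.QuantumFields.YangMills.BalabanUVNodes.N19CoreProductBlocks

open Literature.MathematicalPhysics.QuantumFieldTheory.Balaban1983to89
open T4HybridMatching T4WeightBudget T4IndicatorShell T4MatchingAssembly
open Summit.QuantumFields.BalabanUV.T4Continuum.Spine
open scoped BigOperators

/-! ## §0 Finite-sum bookkeeping on pairs -/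

section Aux

variable {ι₁ ι₂ : Type*} [DecidableEq ι₁] [DecidableEq ι₂]

omit [DecidableEq ι₁] [DecidableEq ι₂] in
/-- `Σ_{(a,b) ∈ s ×ˢ t} f a · g b = (Σ_s f)(Σ_t g)` (`Finset.sum_product` + `Finset.sum_mul_sum`). [folklore] -/
theorem sum_product_mul (s : Finset ι₁) (t : Finset ι₂) (f : ι₁ → ℝ) (g : ι₂ → ℝ) :
    ∑ τ ∈ s ×ˢ t, f τ.1 * g τ.2 = (∑ a ∈ s, f a) * ∑ b ∈ t, g b := by
  rw [Finset.sum_product, Finset.sum_mul_sum]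

/-- the GOOD pairs: `(s ×ˢ t) ∖ (s′ ×ˢ t ∪ s ×ˢ t′) = (s ∖ s′) ×ˢ (t ∖ t′)`. [folklore] -/
theorem product_sdiff_union_product (s s' : Finset ι₁) (t t' : Finset ι₂) :
    (s ×ˢ t) \ (s' ×ˢ t ∪ s ×ˢ t') = (s \ s') ×ˢ (t \ t') := by
  ext ⟨a, b⟩
  simp only [Finset.mem_sdiff, Finset.mem_product, Finset.mem_union, not_or, not_and]
  tauto

/-- a pair is GOOD iff both components are good (membership form of `product_sdiff_union_product`). [folklore] -/
theorem mem_good_prod_iff {s s' : Finset ι₁} {t t' : Finset ι₂} {τ : ι₁ × ι₂} :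
    τ ∈ (s ×ˢ t) \ (s' ×ˢ t ∪ s ×ˢ t') ↔ τ.1 ∈ s \ s' ∧ τ.2 ∈ t \ t' := by
  rw [product_sdiff_union_product, Finset.mem_product]

end Aux

/-! ## §1 TWO INDEPENDENT BLOCKS (index `ι₁ × ι₂`) -/

section Prod

variable {ι₁ ι₂ : Type*} [DecidableEq ι₁] [DecidableEq ι₂] {l₀ vol₁ vol₂ : ℝ}
  {T₁ : ℕ → Finset ι₁} {T₂ : ℕ → Finset ι₂} {Bad₁ : ℕ → ℝ → Finset ι₁} {Bad₂ : ℕ → ℝ → Finset ι₂}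
  {P₁ Q₁ A₁ B₁ shA₁ shB₁ : ℕ → ℝ → ι₁ → ℝ} {P₂ Q₂ A₂ B₂ shA₂ shB₂ : ℕ → ℝ → ι₂ → ℝ}
  {δ₁ δ₂ W₁ W₂ Wsh₁ Wsh₂ : ℕ → ℝ}

/-- **`Core` TENSORIZES.**  Two NE7 cores on independent blocks — `Core l₀ vol₁ T₁ Bad₁ P₁ Q₁ δ₁` and `Core l₀ vol₂ T₂ Bad₂ P₂ Q₂ δ₂`,
run A's good cores nonnegative — give the NE7 core of the PRODUCT datum (classes = pairs, weights = products, a pair bad iff one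
component is bad) with constants `c₁ + c₂` and radius `vol₁·δ₁ + vol₂·δ₂` (stated at `vol := 1`). [folklore] -/
theorem core_prod (h₁ : NE7.Core l₀ vol₁ T₁ Bad₁ P₁ Q₁ δ₁) (h₂ : NE7.Core l₀ vol₂ T₂ Bad₂ P₂ Q₂ δ₂)
    (hP₁ : ∀ K t, |t| ≤ l₀ → ∀ τ ∈ T₁ K \ Bad₁ K t, 0 ≤ P₁ K t τ) (hP₂ : ∀ K t, |t| ≤ l₀ → ∀ τ ∈ T₂ K \ Bad₂ K t, 0 ≤ P₂ K t τ) :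
    NE7.Core l₀ 1 (fun K => T₁ K ×ˢ T₂ K) (fun K t => Bad₁ K t ×ˢ T₂ K ∪ T₁ K ×ˢ Bad₂ K t)
      (fun K t τ => P₁ K t τ.1 * P₂ K t τ.2) (fun K t τ => Q₁ K t τ.1 * Q₂ K t τ.2) (fun K => vol₁ * δ₁ K + vol₂ * δ₂ K) := by
  intro K
  obtain ⟨c₁, hc₁⟩ := h₁ K
  obtain ⟨c₂, hc₂⟩ := h₂ K
  refine ⟨c₁ + c₂, fun t ht τ hτ => ?_⟩
  obtain ⟨hτ₁, hτ₂⟩ := mem_good_prod_iff.1 hτ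
  obtain ⟨l₁, u₁⟩ := hc₁ t ht τ.1 hτ₁
  obtain ⟨l₂, u₂⟩ := hc₂ t ht τ.2 hτ₂
  have hp₁ := hP₁ K t ht τ.1 hτ₁
  have hp₂ := hP₂ K t ht τ.2 hτ₂
  have hq₁ : 0 ≤ Q₁ K t τ.1 := (mul_nonneg (Real.exp_pos _).le hp₁).trans l₁
  have elo : Real.exp (c₁ + c₂ - 1 * (vol₁ * δ₁ K + vol₂ * δ₂ K)) = Real.exp (c₁ - vol₁ * δ₁ K) * Real.exp (c₂ - vol₂ * δ₂ K) := by
    rw [← Real.exp_add]; ring_nf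
  have ehi : Real.exp (c₁ + c₂ + 1 * (vol₁ * δ₁ K + vol₂ * δ₂ K)) = Real.exp (c₁ + vol₁ * δ₁ K) * Real.exp (c₂ + vol₂ * δ₂ K) := by
    rw [← Real.exp_add]; ring_nf
  constructor
  · calc Real.exp (c₁ + c₂ - 1 * (vol₁ * δ₁ K + vol₂ * δ₂ K)) * (P₁ K t τ.1 * P₂ K t τ.2)
        = (Real.exp (c₁ - vol₁ * δ₁ K) * P₁ K t τ.1) * (Real.exp (c₂ - vol₂ * δ₂ K) * P₂ K t τ.2) := by rw [elo]; ring
      _ ≤ Q₁ K t τ.1 * Q₂ K t τ.2 := mul_le_mul l₁ l₂ (mul_nonneg (Real.exp_pos _).le hp₂) hq₁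
  · calc Q₁ K t τ.1 * Q₂ K t τ.2
        ≤ (Real.exp (c₁ + vol₁ * δ₁ K) * P₁ K t τ.1) * (Real.exp (c₂ + vol₂ * δ₂ K) * P₂ K t τ.2) :=
          mul_le_mul u₁ u₂ ((mul_nonneg (Real.exp_pos _).le hp₂).trans l₂) (mul_nonneg (Real.exp_pos _).le hp₁)
      _ = Real.exp (c₁ + c₂ + 1 * (vol₁ * δ₁ K + vol₂ * δ₂ K)) * (P₁ K t τ.1 * P₂ K t τ.2) := by rw [ehi]; ring

/-- rescaling bookkeeping: a core at `vol := 1` with radius `vol·δ` IS the core at volume `vol` with radius letter `δ` (definitional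
up to `one_mul`; the tree's `N19CoreMetric.core_vol_one_iff` by name, restated here to keep this file's imports at `Spine/NE7/Targets`). [folklore] -/
theorem core_of_core_one {ι : Type*} [DecidableEq ι] {vol : ℝ} {T : ℕ → Finset ι} {Bad : ℕ → ℝ → Finset ι} {P Q : ℕ → ℝ → ι → ℝ}
    {δ : ℕ → ℝ} (h : NE7.Core l₀ 1 T Bad P Q fun K => vol * δ K) : NE7.Core l₀ vol T Bad P Q δ := by
  intro K
  obtain ⟨c, hc⟩ := h K
  exact ⟨c, fun t ht τ hτ => by simpa only [one_mul] using hc t ht τ hτ⟩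

/-- **EXTENSIVITY, two blocks**: at a COMMON per-volume radius `δ` the volumes add — `Core l₀ vol₁ … δ` ⊗ `Core l₀ vol₂ … δ` ⟹
`Core l₀ (vol₁ + vol₂) … δ` on the product datum. [folklore] -/
theorem core_prod_sameDelta {δ : ℕ → ℝ} (h₁ : NE7.Core l₀ vol₁ T₁ Bad₁ P₁ Q₁ δ) (h₂ : NE7.Core l₀ vol₂ T₂ Bad₂ P₂ Q₂ δ)
    (hP₁ : ∀ K t, |t| ≤ l₀ → ∀ τ ∈ T₁ K \ Bad₁ K t, 0 ≤ P₁ K t τ) (hP₂ : ∀ K t, |t| ≤ l₀ → ∀ τ ∈ T₂ K \ Bad₂ K t, 0 ≤ P₂ K t τ) :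
    NE7.Core l₀ (vol₁ + vol₂) (fun K => T₁ K ×ˢ T₂ K) (fun K t => Bad₁ K t ×ˢ T₂ K ∪ T₁ K ×ˢ Bad₂ K t)
      (fun K t τ => P₁ K t τ.1 * P₂ K t τ.2) (fun K t τ => Q₁ K t τ.1 * Q₂ K t τ.2) δ :=
  core_of_core_one (by simpa only [add_mul] using core_prod h₁ h₂ hP₁ hP₂)

/-- **`RelWeightBound` (NE7b) TENSORIZES** with bad weight `W₁ + W₂ − W₁·W₂ = 1 − (1 − W₁)(1 − W₂)`: nonnegative, `< 1` and summable
with NO smallness hypothesis; term weights nonnegative on the classes (interface I-2). [folklore] -/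
theorem relWeightBound_prod (h₁ : RelWeightBound l₀ T₁ A₁ B₁ Bad₁ W₁) (h₂ : RelWeightBound l₀ T₂ A₂ B₂ Bad₂ W₂)
    (hA₁ : ∀ K t, |t| ≤ l₀ → ∀ τ ∈ T₁ K, 0 ≤ A₁ K t τ) (hA₂ : ∀ K t, |t| ≤ l₀ → ∀ τ ∈ T₂ K, 0 ≤ A₂ K t τ)
    (hB₁ : ∀ K t, |t| ≤ l₀ → ∀ τ ∈ T₁ K, 0 ≤ B₁ K t τ) (hB₂ : ∀ K t, |t| ≤ l₀ → ∀ τ ∈ T₂ K, 0 ≤ B₂ K t τ) :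
    RelWeightBound l₀ (fun K => T₁ K ×ˢ T₂ K) (fun K t τ => A₁ K t τ.1 * A₂ K t τ.2) (fun K t τ => B₁ K t τ.1 * B₂ K t τ.2)
      (fun K t => Bad₁ K t ×ˢ T₂ K ∪ T₁ K ×ˢ Bad₂ K t) (fun K => W₁ K + W₂ K - W₁ K * W₂ K) := by
  -- the one computation, for a generic pair of nonnegative families dominated classwise
  have key : ∀ (K : ℕ) (t : ℝ), |t| ≤ l₀ → ∀ (F₁ : ι₁ → ℝ) (F₂ : ι₂ → ℝ), (∀ τ ∈ T₁ K, 0 ≤ F₁ τ) → (∀ τ ∈ T₂ K, 0 ≤ F₂ τ) →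
      (∑ τ ∈ Bad₁ K t, F₁ τ ≤ W₁ K * ∑ τ ∈ T₁ K, F₁ τ) → (∑ τ ∈ Bad₂ K t, F₂ τ ≤ W₂ K * ∑ τ ∈ T₂ K, F₂ τ) →
      ∑ τ ∈ Bad₁ K t ×ˢ T₂ K ∪ T₁ K ×ˢ Bad₂ K t, F₁ τ.1 * F₂ τ.2 ≤
        (W₁ K + W₂ K - W₁ K * W₂ K) * ∑ τ ∈ T₁ K ×ˢ T₂ K, F₁ τ.1 * F₂ τ.2 := by
    intro K t ht F₁ F₂ hF₁ hF₂ hb₁ hb₂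
    have hsub : Bad₁ K t ×ˢ T₂ K ∪ T₁ K ×ˢ Bad₂ K t ⊆ T₁ K ×ˢ T₂ K :=
      Finset.union_subset (Finset.product_subset_product_left (h₁.bad_subset K t ht))
        (Finset.product_subset_product_right (h₂.bad_subset K t ht))
    have hsplit := Finset.sum_sdiff (f := fun τ : ι₁ × ι₂ => F₁ τ.1 * F₂ τ.2) hsub
    rw [product_sdiff_union_product, sum_product_mul, sum_product_mul] at hsplit
    have hg₁ := Finset.sum_sdiff (f := F₁) (h₁.bad_subset K t ht)
    have hg₂ := Finset.sum_sdiff (f := F₂) (h₂.bad_subset K t ht)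
    have hS₁ : 0 ≤ ∑ τ ∈ T₁ K, F₁ τ := Finset.sum_nonneg hF₁
    have hS₂ : 0 ≤ ∑ τ ∈ T₂ K, F₂ τ := Finset.sum_nonneg hF₂
    have hG₁ : (1 - W₁ K) * ∑ τ ∈ T₁ K, F₁ τ ≤ ∑ τ ∈ T₁ K \ Bad₁ K t, F₁ τ := by rw [one_sub_mul]; linarith
    have hG₂ : (1 - W₂ K) * ∑ τ ∈ T₂ K, F₂ τ ≤ ∑ τ ∈ T₂ K \ Bad₂ K t, F₂ τ := by rw [one_sub_mul]; linarith
    have hG₁0 : 0 ≤ ∑ τ ∈ T₁ K \ Bad₁ K t, F₁ τ := Finset.sum_nonneg fun τ hτ => hF₁ τ (Finset.mem_sdiff.1 hτ).1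
    have hprod := mul_le_mul hG₁ hG₂ (mul_nonneg (sub_pos.2 (h₂.lt_one K)).le hS₂) hG₁0
    have e : (W₁ K + W₂ K - W₁ K * W₂ K) * ((∑ τ ∈ T₁ K, F₁ τ) * ∑ τ ∈ T₂ K, F₂ τ) =
        (∑ τ ∈ T₁ K, F₁ τ) * (∑ τ ∈ T₂ K, F₂ τ) - (1 - W₁ K) * (∑ τ ∈ T₁ K, F₁ τ) * ((1 - W₂ K) * ∑ τ ∈ T₂ K, F₂ τ) := by ring
    rw [sum_product_mul, e]
    linarith
  exact
  { bad_subset := fun K t ht => Finset.union_subset (Finset.product_subset_product_left (h₁.bad_subset K t ht))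
        (Finset.product_subset_product_right (h₂.bad_subset K t ht))
    nonneg := fun K => by nlinarith [h₁.nonneg K, h₂.nonneg K, h₁.lt_one K, h₂.lt_one K]
    lt_one := fun K => by nlinarith [mul_pos (sub_pos.2 (h₁.lt_one K)) (sub_pos.2 (h₂.lt_one K))]
    summable := (h₁.summable.add h₂.summable).sub
      (h₁.summable.of_nonneg_of_le (fun K => mul_nonneg (h₁.nonneg K) (h₂.nonneg K))
        fun K => mul_le_of_le_one_right (h₁.nonneg K) (h₂.lt_one K).le)
    bad_left := fun K t ht => key K t ht (A₁ K t) (A₂ K t) (hA₁ K t ht) (hA₂ K t ht) (h₁.bad_left K t ht) (h₂.bad_left K t ht)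
    bad_right := fun K t ht => key K t ht (B₁ K t) (B₂ K t) (hB₁ K t ht) (hB₂ K t ht) (h₁.bad_right K t ht) (h₂.bad_right K t ht) }

omit [DecidableEq ι₁] [DecidableEq ι₂] in
/-- **`ShellWeightBound` (NE7c) TENSORIZES** with the product shell `A₁A₂ − (A₁ − shA₁)(A₂ − shA₂)` (so that the product CORE is the
product of the cores) and shell weight `Wsh₁ + Wsh₂`. [folklore] -/
theorem shellWeightBound_prod (h₁ : ShellWeightBound l₀ T₁ A₁ B₁ shA₁ shB₁ Wsh₁) (h₂ : ShellWeightBound l₀ T₂ A₂ B₂ shA₂ shB₂ Wsh₂) :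
    ShellWeightBound l₀ (fun K => T₁ K ×ˢ T₂ K) (fun K t τ => A₁ K t τ.1 * A₂ K t τ.2) (fun K t τ => B₁ K t τ.1 * B₂ K t τ.2)
      (fun K t τ => A₁ K t τ.1 * A₂ K t τ.2 - (A₁ K t τ.1 - shA₁ K t τ.1) * (A₂ K t τ.2 - shA₂ K t τ.2))
      (fun K t τ => B₁ K t τ.1 * B₂ K t τ.2 - (B₁ K t τ.1 - shB₁ K t τ.1) * (B₂ K t τ.2 - shB₂ K t τ.2))
      (fun K => Wsh₁ K + Wsh₂ K) := by
  -- termwise: `0 ≤ F·G − (F − f)(G − g) ≤ F·G` for `0 ≤ f ≤ F`, `0 ≤ g ≤ G`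
  have term : ∀ (F f G g : ℝ), 0 ≤ f → f ≤ F → 0 ≤ g → g ≤ G → 0 ≤ F * G - (F - f) * (G - g) ∧ F * G - (F - f) * (G - g) ≤ F * G := by
    intro F f G g hf hfF hg hgG
    have hF : 0 ≤ F := hf.trans hfF
    have h1 : (F - f) * (G - g) ≤ F * G := mul_le_mul (sub_le_self F hf) (sub_le_self G hg) (sub_nonneg.2 hgG) hF
    have h2 : 0 ≤ (F - f) * (G - g) := mul_nonneg (sub_nonneg.2 hfF) (sub_nonneg.2 hgG)
    exact ⟨sub_nonneg.2 h1, sub_le_self _ h2⟩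
  -- the total: `Σ (FG − (F−f)(G−g)) = Sh₁S₂ + S₁Sh₂ − Sh₁Sh₂ ≤ (w₁ + w₂) S₁S₂`
  have tot : ∀ (K : ℕ) (t : ℝ), |t| ≤ l₀ → ∀ (F₁ f₁ : ι₁ → ℝ) (F₂ f₂ : ι₂ → ℝ),
      (∀ τ ∈ T₁ K, 0 ≤ f₁ τ) → (∀ τ ∈ T₁ K, f₁ τ ≤ F₁ τ) → (∀ τ ∈ T₂ K, 0 ≤ f₂ τ) → (∀ τ ∈ T₂ K, f₂ τ ≤ F₂ τ) →
      (∑ τ ∈ T₁ K, f₁ τ ≤ Wsh₁ K * ∑ τ ∈ T₁ K, F₁ τ) → (∑ τ ∈ T₂ K, f₂ τ ≤ Wsh₂ K * ∑ τ ∈ T₂ K, F₂ τ) →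
      ∑ τ ∈ T₁ K ×ˢ T₂ K, (F₁ τ.1 * F₂ τ.2 - (F₁ τ.1 - f₁ τ.1) * (F₂ τ.2 - f₂ τ.2)) ≤
        (Wsh₁ K + Wsh₂ K) * ∑ τ ∈ T₁ K ×ˢ T₂ K, F₁ τ.1 * F₂ τ.2 := by
    intro K t ht F₁ f₁ F₂ f₂ hf₁ hfF₁ hf₂ hfF₂ hw₁ hw₂
    rw [Finset.sum_sub_distrib, sum_product_mul, sum_product_mul (f := fun a => F₁ a - f₁ a) (g := fun b => F₂ b - f₂ b),
      Finset.sum_sub_distrib, Finset.sum_sub_distrib]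
    have hS₁ : 0 ≤ ∑ τ ∈ T₁ K, F₁ τ := Finset.sum_nonneg fun τ hτ => (hf₁ τ hτ).trans (hfF₁ τ hτ)
    have hS₂ : 0 ≤ ∑ τ ∈ T₂ K, F₂ τ := Finset.sum_nonneg fun τ hτ => (hf₂ τ hτ).trans (hfF₂ τ hτ)
    have hSh₁ : 0 ≤ ∑ τ ∈ T₁ K, f₁ τ := Finset.sum_nonneg hf₁
    have hSh₂ : 0 ≤ ∑ τ ∈ T₂ K, f₂ τ := Finset.sum_nonneg hf₂
    have e1 := mul_le_mul_of_nonneg_right hw₁ hS₂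
    have e2 := mul_le_mul_of_nonneg_left hw₂ hS₁
    have e3 := mul_nonneg hSh₁ hSh₂
    nlinarith
  exact
  { nonneg := fun K => add_nonneg (h₁.nonneg K) (h₂.nonneg K)
    summable := h₁.summable.add h₂.summable
    sh_nonneg_left := fun K t ht τ hτ =>
      (term _ _ _ _ (h₁.sh_nonneg_left K t ht τ.1 (Finset.mem_product.1 hτ).1) (h₁.sh_le_left K t ht τ.1 (Finset.mem_product.1 hτ).1)
        (h₂.sh_nonneg_left K t ht τ.2 (Finset.mem_product.1 hτ).2) (h₂.sh_le_left K t ht τ.2 (Finset.mem_product.1 hτ).2)).1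
    sh_le_left := fun K t ht τ hτ =>
      (term _ _ _ _ (h₁.sh_nonneg_left K t ht τ.1 (Finset.mem_product.1 hτ).1) (h₁.sh_le_left K t ht τ.1 (Finset.mem_product.1 hτ).1)
        (h₂.sh_nonneg_left K t ht τ.2 (Finset.mem_product.1 hτ).2) (h₂.sh_le_left K t ht τ.2 (Finset.mem_product.1 hτ).2)).2
    sh_nonneg_right := fun K t ht τ hτ =>
      (term _ _ _ _ (h₁.sh_nonneg_right K t ht τ.1 (Finset.mem_product.1 hτ).1) (h₁.sh_le_right K t ht τ.1 (Finset.mem_product.1 hτ).1)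
        (h₂.sh_nonneg_right K t ht τ.2 (Finset.mem_product.1 hτ).2) (h₂.sh_le_right K t ht τ.2 (Finset.mem_product.1 hτ).2)).1
    sh_le_right := fun K t ht τ hτ =>
      (term _ _ _ _ (h₁.sh_nonneg_right K t ht τ.1 (Finset.mem_product.1 hτ).1) (h₁.sh_le_right K t ht τ.1 (Finset.mem_product.1 hτ).1)
        (h₂.sh_nonneg_right K t ht τ.2 (Finset.mem_product.1 hτ).2) (h₂.sh_le_right K t ht τ.2 (Finset.mem_product.1 hτ).2)).2
    left := fun K t ht => tot K t ht _ _ _ _ (h₁.sh_nonneg_left K t ht) (h₁.sh_le_left K t ht) (h₂.sh_nonneg_left K t ht)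
      (h₂.sh_le_left K t ht) (h₁.left K t ht) (h₂.left K t ht)
    right := fun K t ht => tot K t ht _ _ _ _ (h₁.sh_nonneg_right K t ht) (h₁.sh_le_right K t ht) (h₂.sh_nonneg_right K t ht)
      (h₂.sh_le_right K t ht) (h₁.right K t ht) (h₂.right K t ht) }

/-- **`HybridNE7` TENSORIZES modulo the DISPLAYED joint smallness** `hlt : W⊗ + Wsh⊗ < 1` (the one clause of node U5's datum that
does not compose from the factors' `W_b + Wsh_b < 1`): weight `W₁ + W₂ − W₁W₂`, product shells with weight `Wsh₁ + Wsh₂`, remainder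
`vol₁·δ₁ + vol₂·δ₂` (at `vol := 1`), and the product CORE = the product of the cores (`core_prod`). Term nonnegativity comes from the
shell clauses (`0 ≤ sh ≤ term`). [folklore] -/
theorem hybridNE7_prod (h₁ : HybridNE7 l₀ vol₁ T₁ A₁ B₁ Bad₁ W₁ shA₁ shB₁ Wsh₁ δ₁) (h₂ : HybridNE7 l₀ vol₂ T₂ A₂ B₂ Bad₂ W₂ shA₂ shB₂ Wsh₂ δ₂)
    (hlt : ∀ K, (W₁ K + W₂ K - W₁ K * W₂ K) + (Wsh₁ K + Wsh₂ K) < 1) :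
    HybridNE7 l₀ 1 (fun K => T₁ K ×ˢ T₂ K) (fun K t τ => A₁ K t τ.1 * A₂ K t τ.2) (fun K t τ => B₁ K t τ.1 * B₂ K t τ.2)
      (fun K t => Bad₁ K t ×ˢ T₂ K ∪ T₁ K ×ˢ Bad₂ K t) (fun K => W₁ K + W₂ K - W₁ K * W₂ K)
      (fun K t τ => A₁ K t τ.1 * A₂ K t τ.2 - (A₁ K t τ.1 - shA₁ K t τ.1) * (A₂ K t τ.2 - shA₂ K t τ.2))
      (fun K t τ => B₁ K t τ.1 * B₂ K t τ.2 - (B₁ K t τ.1 - shB₁ K t τ.1) * (B₂ K t τ.2 - shB₂ K t τ.2))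
      (fun K => Wsh₁ K + Wsh₂ K) (fun K => vol₁ * δ₁ K + vol₂ * δ₂ K) where
  weight := relWeightBound_prod h₁.weight h₂.weight
    (fun K t ht τ hτ => (h₁.shell.sh_nonneg_left K t ht τ hτ).trans (h₁.shell.sh_le_left K t ht τ hτ))
    (fun K t ht τ hτ => (h₂.shell.sh_nonneg_left K t ht τ hτ).trans (h₂.shell.sh_le_left K t ht τ hτ))
    (fun K t ht τ hτ => (h₁.shell.sh_nonneg_right K t ht τ hτ).trans (h₁.shell.sh_le_right K t ht τ hτ))
    (fun K t ht τ hτ => (h₂.shell.sh_nonneg_right K t ht τ hτ).trans (h₂.shell.sh_le_right K t ht τ hτ))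
  shell := shellWeightBound_prod h₁.shell h₂.shell
  lt_one := hlt
  summable := (h₁.summable.mul_left vol₁).add (h₂.summable.mul_left vol₂)
  core := by
    have hc := core_prod (NE7.core_of_hybridNE7 h₁) (NE7.core_of_hybridNE7 h₂)
      (fun K t ht τ hτ => sub_nonneg.2 (h₁.shell.sh_le_left K t ht τ (Finset.mem_sdiff.1 hτ).1))
      (fun K t ht τ hτ => sub_nonneg.2 (h₂.shell.sh_le_left K t ht τ (Finset.mem_sdiff.1 hτ).1))
    intro K
    obtain ⟨c, hc⟩ := hc K
    refine ⟨c, fun t ht τ hτ => ?_⟩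
    simpa only [sub_sub_cancel] using hc t ht τ hτ

/-- **NODE U5's TARGET TENSORIZES** (the scheme-level face of `core_prod`): if two POSITIVE partition-function sequences match modulo
constants — `MatchingModConstants vol₁ l₀ δ₁ Z₁`, `MatchingModConstants vol₂ l₀ δ₂ Z₂` — then so does their PRODUCT `Z₁·Z₂` (the
partition function of two independent blocks), with constants `c₁ + c₂` and radius `vol₁·δ₁ + vol₂·δ₂` (at `vol := 1`): `log` of a
product is the sum, and the defects add (`abs_sub_le`-type triangle inequality). [folklore] -/
theorem matchingModConstants_mul {Z₁ Z₂ : ℕ → ℝ → ℝ} (h₁ : T4CauchySum.MatchingModConstants vol₁ l₀ δ₁ Z₁)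
    (h₂ : T4CauchySum.MatchingModConstants vol₂ l₀ δ₂ Z₂) (hZ₁ : ∀ K t, |t| ≤ l₀ → 0 < Z₁ K t) (hZ₂ : ∀ K t, |t| ≤ l₀ → 0 < Z₂ K t) :
    T4CauchySum.MatchingModConstants 1 l₀ (fun K => vol₁ * δ₁ K + vol₂ * δ₂ K) fun K t => Z₁ K t * Z₂ K t := by
  intro K
  obtain ⟨c₁, hc₁⟩ := h₁ K
  obtain ⟨c₂, hc₂⟩ := h₂ K
  refine ⟨c₁ + c₂, fun t ht => ?_⟩
  have e₁ := hc₁ t ht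
  have e₂ := hc₂ t ht
  rw [Real.log_mul (hZ₁ (K + 1) t ht).ne' (hZ₂ (K + 1) t ht).ne', Real.log_mul (hZ₁ K t ht).ne' (hZ₂ K t ht).ne', one_mul]
  calc |Real.log (Z₁ (K + 1) t) + Real.log (Z₂ (K + 1) t) - (Real.log (Z₁ K t) + Real.log (Z₂ K t)) - (c₁ + c₂)|
      = |(Real.log (Z₁ (K + 1) t) - Real.log (Z₁ K t) - c₁) + (Real.log (Z₂ (K + 1) t) - Real.log (Z₂ K t) - c₂)| := by ring_nf
    _ ≤ |Real.log (Z₁ (K + 1) t) - Real.log (Z₁ K t) - c₁| + |Real.log (Z₂ (K + 1) t) - Real.log (Z₂ K t) - c₂| := abs_add_le _ _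
    _ ≤ vol₁ * δ₁ K + vol₂ * δ₂ K := add_le_add e₁ e₂

/-- … with the summable remainders: node U5's `Target` (`MatchingModConstants ∧ Summable δ`) of two independent positive blocks gives the
`Target` of their product. [folklore] -/
theorem target_mul {Z₁ Z₂ : ℕ → ℝ → ℝ} (h₁ : NE7.Target vol₁ l₀ δ₁ Z₁) (h₂ : NE7.Target vol₂ l₀ δ₂ Z₂)
    (hZ₁ : ∀ K t, |t| ≤ l₀ → 0 < Z₁ K t) (hZ₂ : ∀ K t, |t| ≤ l₀ → 0 < Z₂ K t) :
    NE7.Target 1 l₀ (fun K => vol₁ * δ₁ K + vol₂ * δ₂ K) fun K t => Z₁ K t * Z₂ K t :=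
  ⟨matchingModConstants_mul h₁.1 h₂.1 hZ₁ hZ₂, (h₁.2.mul_left vol₁).add (h₂.2.mul_left vol₂)⟩

/-- **THE WEIGHT REMAINDER IS EXTENSIVE TOO**: with the product bad weight `W⊗ = W₁ + W₂ − W₁W₂ = 1 − (1 − W₁)(1 − W₂)`,
`−log(1 − W⊗) = −log(1 − W₁) − log(1 − W₂)` — `T4HybridMatching.hybridDelta`'s second summand adds over independent blocks exactly as
the first does (`W₁, W₂ < 1`). [folklore] -/
theorem neg_log_one_sub_prodWeight {w₁ w₂ : ℝ} (h₁ : w₁ < 1) (h₂ : w₂ < 1) :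
    -Real.log (1 - (w₁ + w₂ - w₁ * w₂)) = -Real.log (1 - w₁) + -Real.log (1 - w₂) := by
  have e : 1 - (w₁ + w₂ - w₁ * w₂) = (1 - w₁) * (1 - w₂) := by ring
  rw [e, Real.log_mul (sub_pos.2 h₁).ne' (sub_pos.2 h₂).ne', neg_add]

/-- … hence the shell-free HYBRID REMAINDER of the product datum is the volume-weighted SUM of the blocks' hybrid remainders:
`hybridDelta 1 (vol₁δ₁ + vol₂δ₂) W⊗ K = vol₁·hybridDelta vol₁ δ₁ W₁ K + vol₂·hybridDelta vol₂ δ₂ W₂ K` (`vol₁, vol₂ ≠ 0`, `W₁ K, W₂ K < 1`)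
— the remainder sequence that `HybridNE7.matchingModConstants` hands to node U6 is extensive, consistently with `matchingModConstants_mul`.
[folklore] -/
theorem hybridDelta_prod (hv₁ : vol₁ ≠ 0) (hv₂ : vol₂ ≠ 0) {K : ℕ} (h₁ : W₁ K < 1) (h₂ : W₂ K < 1) :
    hybridDelta 1 (fun K => vol₁ * δ₁ K + vol₂ * δ₂ K) (fun K => W₁ K + W₂ K - W₁ K * W₂ K) K =
      vol₁ * hybridDelta vol₁ δ₁ W₁ K + vol₂ * hybridDelta vol₂ δ₂ W₂ K := by
  rw [mul_hybridDelta hv₁, mul_hybridDelta hv₂, ← one_mul (hybridDelta 1 _ _ K), mul_hybridDelta one_ne_zero]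
  simp only [one_mul]
  rw [sub_eq_add_neg, neg_log_one_sub_prodWeight h₁ h₂]
  ring

end Prod

end Summit.QuantumFields.YangMills.BalabanUVNodes.N19CoreProductBlocks

end
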